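import Literature.Combinatorics.SimpleGraph.LiftSparsity
import Literature.Combinatorics.SimpleGraph.LiftSparsityNumerics
import HarnessLib

/-!
# Existence of sparse lifts without large independent sets

Topic `Literature/Combinatorics/SimpleGraph`.  The probabilistic (counting) step of the
random-graph input for Conneryd–Ghannane–Pang 2025, Theorem 6.1: among all lifts
`π : UpEdge B → Perm (Fin a)` of a base graph `B` on `w ≥ 1` vertices in which every vertex is
non-adjacent to at most `3` vertices,

* at most a quarter have an independent `t`-set, as soon as the numerics
  `C(wa, t) · exp(-(t² - 3at)/(2a)) ≤ 1/4` hold (`card_indepBad_le`, from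
  `sum_card_indepLifts_le`);
* at most a quarter have a set `U` with `1 ≤ |U| ≤ ℓ := a / (16 q (16 w)^q)` spanning
  `≥ |U| + |U|/q + 1` edges (`card_sparseBad_le`, from `card_denseLifts_mul_le` and
  `sparsity_sum_le`);

hence **`exists_good_lift`**: some lift has no independent `t`-set and is `(ℓ, 1/q)`-sparse
(`isSparse_of_forall_lt`: `e(U) < |U| + |U|/q + 1` is `e(U) ≤ (1 + 1/q)|U|`).

## References

* [ConnerydGhannanePang2025] arXiv:2511.17272, Lemmas 6.2 and 6.4 (the properties, there for
  `𝒢_{n,d}` via [KPGW10, CFRR02]); here obtained for random lifts by the first-moment method.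
* [folklore] the probabilistic method.
-/

noncomputable section

namespace Literature.Combinatorics.SimpleGraph

open Finset Literature.Combinatorics.Enumerative
open Literature.ModelTheory.FiniteModelTheory.ConnerydGhannanePang (edgesIn mem_edgesIn IsSparse)

variable {W : Type*} [LinearOrder W] [Fintype W] {B : _root_.SimpleGraph W} [DecidableRel B.Adj] {a : ℕ}

/-- The number of lifts: `(a!)^{|E|}`. [folklore] -/
theorem card_lifts : Fintype.card (UpEdge B → Equiv.Perm (Fin a)) = a.factorial ^ Fintype.card (UpEdge B) := by
  rw [Fintype.card_fun, Fintype.card_perm, Fintype.card_fin]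

/-! ### Lifts with a large independent set -/

/-- The lifts having an independent `t`-set. [folklore] -/
def indepBad (t : ℕ) : Finset (UpEdge B → Equiv.Perm (Fin a)) :=
  Finset.univ.filter fun π => ∃ T : Finset (W × Fin a), T.card = t ∧ ∀ u ∈ T, ∀ v ∈ T, ¬ (liftGraph π).Adj u v

/-- **At most `C(wa,t)·(a!)^{|E|}·exp(-(t²-3at)/(2a))` lifts have an independent `t`-set.**
[folklore] -/
theorem card_indepBad_le (ha : 0 < a) (hB : ∀ x, Fintype.card W ≤ B.degree x + 3) (t : ℕ) :
    ((indepBad (B := B) (a := a) t).card : ℝ) ≤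
      ((Fintype.card W * a).choose t : ℝ) * (a.factorial : ℝ) ^ Fintype.card (UpEdge B) *
        Real.exp (-((t : ℝ) ^ 2 - 3 * a * t) / (2 * a)) := by
  classical
  have hsub : indepBad (B := B) (a := a) t ⊆
      ((Finset.univ : Finset (W × Fin a)).powersetCard t).biUnion fun T => indepLifts T := by
    intro π hπ
    obtain ⟨T, hTt, hT⟩ := (Finset.mem_filter.1 hπ).2
    rw [Finset.mem_biUnion]
    exact ⟨T, Finset.mem_powersetCard.2 ⟨Finset.subset_univ _, hTt⟩, mem_indepLifts.2 hT⟩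
  calc ((indepBad (B := B) (a := a) t).card : ℝ)
      ≤ ((((Finset.univ : Finset (W × Fin a)).powersetCard t).biUnion fun T => indepLifts (B := B) T).card : ℝ) := by
        exact_mod_cast Finset.card_le_card hsub
    _ ≤ ∑ T ∈ (Finset.univ : Finset (W × Fin a)).powersetCard t, ((indepLifts (B := B) T).card : ℝ) := by
        exact_mod_cast Finset.card_biUnion_le
    _ ≤ _ := sum_card_indepLifts_le ha hB t

/-! ### Lifts with a dense small set -/

/-- The lifts having a set `U`, `1 ≤ |U| ≤ ℓ`, spanning `≥ |U| + |U|/q + 1` edges. [folklore] -/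
def sparseBad (q ℓ : ℕ) : Finset (UpEdge B → Equiv.Perm (Fin a)) :=
  (Finset.Icc 1 ℓ).biUnion fun u => denseLifts u (u + u / q + 1)

/-- **At most a quarter of the lifts have a dense small set**, for `ℓ = a / (16 q (16 w)^q)`.
[folklore] -/
theorem card_sparseBad_le {q : ℕ} (hq : 1 ≤ q) (hw : 1 ≤ Fintype.card W) (ha : 1 ≤ a) :
    ((sparseBad (B := B) (a := a) q (a / (16 * q * (16 * Fintype.card W) ^ q))).card : ℝ) ≤
      (a.factorial : ℝ) ^ Fintype.card (UpEdge B) / 4 := by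
  set w := Fintype.card W with hw'
  set K := 16 * q * (16 * w) ^ q with hK
  set ℓ := a / K with hℓ
  have hKpos : 0 < K := Nat.mul_pos (by omega) (pow_pos (by omega) q)
  have hℓa : 16 * q * (16 * w) ^ q * ℓ ≤ a := by rw [← hK, hℓ]; exact Nat.mul_div_le a K
  have hF : (0 : ℝ) < (a.factorial : ℝ) ^ Fintype.card (UpEdge B) := by positivity
  -- per `u`
  have hu : ∀ u ∈ Finset.Icc 1 ℓ, ((denseLifts (B := B) (a := a) u (u + u / q + 1)).card : ℝ) ≤
      ((w * a).choose u : ℝ) * ((u ^ 2).choose (u + u / q + 1) : ℝ) /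
        ((a : ℝ) - (u + u / q + 1 : ℕ)) ^ (u + u / q + 1) * (a.factorial : ℝ) ^ Fintype.card (UpEdge B) := by
    intro u hu
    rw [Finset.mem_Icc] at hu
    set j := u + u / q + 1 with hj
    have hja : j < a := by
      have h1 : u / q ≤ u := Nat.div_le_self u q
      have h2 : 16 * ℓ ≤ K * ℓ := Nat.mul_le_mul_right _ (by
        have : 1 ≤ q * (16 * w) ^ q := Nat.one_le_iff_ne_zero.2 (Nat.mul_ne_zero (by omega)
          (pow_ne_zero _ (by omega)))
        calc 16 = 16 * 1 := rfl
          _ ≤ 16 * (q * (16 * w) ^ q) := Nat.mul_le_mul_left _ this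
          _ = K := by rw [hK]; ring)
      have h3 : K * ℓ ≤ a := by rw [hℓ]; exact Nat.mul_div_le a K
      omega
    have key := card_denseLifts_mul_le (B := B) (a := a) (u := u) hja.le
    have hpos : (0 : ℝ) < ((a : ℝ) - (j : ℕ)) ^ j := by
      apply pow_pos
      have : ((j : ℕ) : ℝ) < a := by exact_mod_cast hja
      linarith
    rw [div_mul_eq_mul_div, le_div_iff₀ hpos]
    have hcast : ((a : ℝ) - (j : ℕ)) ^ j = (((a - j : ℕ) : ℝ)) ^ j := by
      rw [Nat.cast_sub hja.le]
    rw [hcast]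
    exact_mod_cast key
  calc ((sparseBad (B := B) (a := a) q ℓ).card : ℝ)
      ≤ ∑ u ∈ Finset.Icc 1 ℓ, ((denseLifts (B := B) (a := a) u (u + u / q + 1)).card : ℝ) := by
        rw [sparseBad]; exact_mod_cast Finset.card_biUnion_le
    _ ≤ ∑ u ∈ Finset.Icc 1 ℓ, ((w * a).choose u : ℝ) * ((u ^ 2).choose (u + u / q + 1) : ℝ) /
          ((a : ℝ) - (u + u / q + 1 : ℕ)) ^ (u + u / q + 1) * (a.factorial : ℝ) ^ Fintype.card (UpEdge B) :=
        Finset.sum_le_sum hu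
    _ = (∑ u ∈ Finset.Icc 1 ℓ, ((w * a).choose u : ℝ) * ((u ^ 2).choose (u + u / q + 1) : ℝ) /
          ((a : ℝ) - (u + u / q + 1 : ℕ)) ^ (u + u / q + 1)) * (a.factorial : ℝ) ^ Fintype.card (UpEdge B) := by
        rw [Finset.sum_mul]
    _ ≤ 1 / 4 * (a.factorial : ℝ) ^ Fintype.card (UpEdge B) :=
        mul_le_mul_of_nonneg_right (sparsity_sum_le hq hw hℓa ha) hF.le
    _ = (a.factorial : ℝ) ^ Fintype.card (UpEdge B) / 4 := by ring

/-! ### Good lifts -/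

/-- `e(U) < |U| + |U|/q + 1` for `1 ≤ |U| ≤ ℓ` means `(ℓ, 1/q)`-sparse. [folklore] -/
theorem isSparse_of_forall_lt {V : Type*} [DecidableEq V] [Fintype V] (G : _root_.SimpleGraph V)
    [DecidableRel G.Adj] {q ℓ : ℕ} (hq : 1 ≤ q)
    (h : ∀ U : Finset V, 1 ≤ U.card → U.card ≤ ℓ → (edgesIn G U).card < U.card + U.card / q + 1) :
    IsSparse G ℓ (1 / q) := by
  intro U hUℓ
  rcases Nat.eq_zero_or_pos U.card with h0 | hpos
  · have hU : U = ∅ := Finset.card_eq_zero.1 h0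
    subst hU
    have : edgesIn G (∅ : Finset V) = ∅ := by
      ext e; simp [edgesIn]
    simp [this]
  · have hlt := h U hpos hUℓ
    have hle : (edgesIn G U).card ≤ U.card + U.card / q := Nat.lt_succ_iff.1 hlt
    have hq0 : (0 : ℝ) < q := by exact_mod_cast hq
    calc ((edgesIn G U).card : ℝ) ≤ ((U.card + U.card / q : ℕ) : ℝ) := by exact_mod_cast hle
      _ ≤ (U.card : ℝ) + (U.card : ℝ) / q := by push_cast; gcongr; exact Nat.cast_div_le
      _ = (1 + 1 / q) * U.card := by ring

/-- **Existence of a good lift** (core form): if at most a quarter of the lifts of `B` (`w ≥ 1`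
vertices, fibres of size `a ≥ 1`) have an independent `t`-set, some lift has NO independent
`t`-set and is `(a / (16 q (16 w)^q), 1/q)`-sparse. [folklore] -/
theorem exists_good_lift_of_card_le {q : ℕ} (hq : 1 ≤ q) (hw : 1 ≤ Fintype.card W) (ha : 1 ≤ a)
    {t : ℕ} (hind : ((indepBad (B := B) (a := a) t).card : ℝ) ≤
      (a.factorial : ℝ) ^ Fintype.card (UpEdge B) / 4) :
    ∃ π : UpEdge B → Equiv.Perm (Fin a),
      (∀ T : Finset (W × Fin a), T.card = t → ∃ u ∈ T, ∃ v ∈ T, (liftGraph π).Adj u v) ∧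
      IsSparse (liftGraph π) (a / (16 * q * (16 * Fintype.card W) ^ q)) (1 / q) := by
  classical
  set ℓ := a / (16 * q * (16 * Fintype.card W) ^ q) with hℓ
  set Bad := indepBad (B := B) (a := a) t ∪ sparseBad (B := B) (a := a) q ℓ with hBad
  have hΩ : ((Finset.univ : Finset (UpEdge B → Equiv.Perm (Fin a))).card : ℝ) =
      (a.factorial : ℝ) ^ Fintype.card (UpEdge B) := by
    rw [Finset.card_univ, card_lifts]; push_cast; rfl
  have h2 := card_sparseBad_le (B := B) (a := a) hq hw ha
  have hF : (0 : ℝ) < (a.factorial : ℝ) ^ Fintype.card (UpEdge B) := by positivity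
  have hBadcard : (Bad.card : ℝ) < (Finset.univ : Finset (UpEdge B → Equiv.Perm (Fin a))).card := by
    calc (Bad.card : ℝ) ≤ ((indepBad (B := B) (a := a) t).card : ℝ) + (sparseBad (B := B) (a := a) q ℓ).card := by
          exact_mod_cast Finset.card_union_le _ _
      _ ≤ (a.factorial : ℝ) ^ Fintype.card (UpEdge B) / 4 + (a.factorial : ℝ) ^ Fintype.card (UpEdge B) / 4 :=
          add_le_add hind h2
      _ < (a.factorial : ℝ) ^ Fintype.card (UpEdge B) := by linarith
      _ = _ := hΩ.symm
  have hne : ∃ π, π ∉ Bad := by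
    by_contra hall
    push Not at hall
    have : (Finset.univ : Finset (UpEdge B → Equiv.Perm (Fin a))) ⊆ Bad := fun π _ => hall π
    have := Finset.card_le_card this
    exact absurd hBadcard (not_lt.2 (by exact_mod_cast this))
  obtain ⟨π, hπ⟩ := hne
  rw [hBad, Finset.mem_union, not_or] at hπ
  refine ⟨π, fun T hT => ?_, isSparse_of_forall_lt _ hq fun U hU1 hUℓ => ?_⟩
  · by_contra hno
    push Not at hno
    exact hπ.1 (Finset.mem_filter.2 ⟨Finset.mem_univ _, T, hT, fun u hu v hv => hno u hu v hv⟩)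
  · by_contra hge
    push Not at hge
    refine hπ.2 ?_
    rw [sparseBad, Finset.mem_biUnion]
    exact ⟨U.card, Finset.mem_Icc.2 ⟨hU1, hUℓ⟩, mem_denseLifts.2 ⟨U, rfl, hge⟩⟩

/-- **Existence of a good lift**: if every vertex of `B` is non-adjacent to at most `3` vertices
and the independence numerics `C(wa, t)·exp(-(t² - 3at)/(2a)) ≤ 1/4` hold, some lift has no
independent `t`-set and is `(a / (16 q (16 w)^q), 1/q)`-sparse. [folklore] -/
theorem exists_good_lift {q : ℕ} (hq : 1 ≤ q) (hw : 1 ≤ Fintype.card W) (ha : 1 ≤ a)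
    (hB : ∀ x, Fintype.card W ≤ B.degree x + 3) {t : ℕ}
    (ht : ((Fintype.card W * a).choose t : ℝ) * Real.exp (-((t : ℝ) ^ 2 - 3 * a * t) / (2 * a)) ≤ 1 / 4) :
    ∃ π : UpEdge B → Equiv.Perm (Fin a),
      (∀ T : Finset (W × Fin a), T.card = t → ∃ u ∈ T, ∃ v ∈ T, (liftGraph π).Adj u v) ∧
      IsSparse (liftGraph π) (a / (16 * q * (16 * Fintype.card W) ^ q)) (1 / q) := by
  refine exists_good_lift_of_card_le hq hw ha ((card_indepBad_le (B := B) ha hB t).trans ?_)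
  have hF : (0 : ℝ) ≤ (a.factorial : ℝ) ^ Fintype.card (UpEdge B) := by positivity
  calc ((Fintype.card W * a).choose t : ℝ) * (a.factorial : ℝ) ^ Fintype.card (UpEdge B) *
        Real.exp (-((t : ℝ) ^ 2 - 3 * a * t) / (2 * a))
      = ((Fintype.card W * a).choose t : ℝ) * Real.exp (-((t : ℝ) ^ 2 - 3 * a * t) / (2 * a)) *
          (a.factorial : ℝ) ^ Fintype.card (UpEdge B) := by ring
    _ ≤ 1 / 4 * (a.factorial : ℝ) ^ Fintype.card (UpEdge B) := mul_le_mul_of_nonneg_right ht hF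
    _ = _ := by ring

/-- **Existence of a sparse lift** (no independence requirement): some lift of any base `B`
(`w ≥ 1` vertices, fibres of size `a ≥ 1`) is `(a / (16 q (16 w)^q), 1/q)`-sparse. [folklore] -/
theorem exists_sparse_lift {q : ℕ} (hq : 1 ≤ q) (hw : 1 ≤ Fintype.card W) (ha : 1 ≤ a) :
    ∃ π : UpEdge B → Equiv.Perm (Fin a),
      IsSparse (liftGraph π) (a / (16 * q * (16 * Fintype.card W) ^ q)) (1 / q) := by
  classical
  -- no `(wa + 1)`-subsets exist
  have hempty : indepBad (B := B) (a := a) (Fintype.card W * a + 1) = ∅ := by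
    refine Finset.eq_empty_of_forall_notMem fun π hπ => ?_
    obtain ⟨T, hT, -⟩ := (Finset.mem_filter.1 hπ).2
    have := Finset.card_le_univ T
    rw [Fintype.card_prod, Fintype.card_fin, hT] at this
    omega
  obtain ⟨π, -, hπ⟩ := exists_good_lift_of_card_le (B := B) (a := a) hq hw ha
    (t := Fintype.card W * a + 1) (by rw [hempty, Finset.card_empty, Nat.cast_zero]; positivity)
  exact ⟨π, hπ⟩

end Literature.Combinatorics.SimpleGraph
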